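import Summits.Ventures.QEC.CircuitDistance.PortK2DataBB144X
import Summits.Ventures.QEC.CircuitDistance.K2Chunks
import HarnessLib

/-!
# K2(`[[144,12,12]]`) chunk module — COMPUTATIONAL (native_decide; `Lean.ofReduceBool`)

Cell `qec`, CDX, R146/R152 STEP 1 («computational» header; `ofReduceBool` confined to these chunk modules). Checker of record
`K2.K2Data` (qec-cdx-type-1, PortK2Check); data module of record `PortK2DataBB144X/Z` (p669158/9, crit-1 data audit PASS
2026-08-28T21:20Z); chunk glue `K2Chunks` (idea-1 g2). Cube 1, child 10: leaf group 1 of 3.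
Leaf theorems: the K2 DFS accepts below one descendant state of pivot cube 1 (sector X); sizes are exact DFS visit counts
(eng-1 g2 `k2count.c`), capped so that the gate's native-axiom audit re-verifies every leaf in place. Assemblies re-derive the
child lists in the kernel (`decide`) and end in the literal cube fact `d144X.cube (Ts144X.getD 1 []) (72) (lives144X.getD 1 0) = true`
(the `hcubes` hypothesis of `K2Inst.k2_complete`). Emitted by qec-cdx-eng-1 g2 (`gen2.py`, idea-1's `gen_k2chunks_from_lean.py` lineage).
-/

namespace Summit.Ventures.QEC.CircuitDistance.K2

set_option maxRecDepth 100000 in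
set_option maxHeartbeats 0 in
set_option exponentiation.threshold 1024 in
/-- K2(144) chunk fact `cube144X1_ch10_0` (557152 DFS visits; see the module docstring). -/
theorem cube144X1_ch10_0 : app5 (d144X.dfs (Ts144X.getD 1 []) 6) (313594649253063168008, 928, 121416805764108066932466369176469931665150427440758720078238289775780966434261172224, 3, 2348542582773833227889480475313245713578108828401410385976285178793514908977793939319501139351055553966112768) = true := by native_decide

set_option maxRecDepth 100000 in
set_option maxHeartbeats 0 in
set_option exponentiation.threshold 1024 in
/-- K2(144) chunk fact `cube144X1_ch10_1` (407422 DFS visits; see the module docstring). -/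
theorem cube144X1_ch10_1 : app5 (d144X.dfs (Ts144X.getD 1 []) 6) (314026994817290211328, 2016, 121416805764108066932466369176469931665150427781041086999176743794422608126738956288, 3, 2348542582773833227889480475313245713578108828401410385976285178793514568695427018381037675976448122197901312) = true := by native_decide

set_option maxRecDepth 100000 in
set_option maxHeartbeats 0 in
set_option exponentiation.threshold 1024 in
/-- K2(144) chunk fact `cube144X1_ch10_2` (416019 DFS visits; see the module docstring). -/
theorem cube144X1_ch10_2 : app5 (d144X.dfs (Ts144X.getD 1 []) 6) (313594649261786667008, 2221, 121416805764108066932466369176469931665328833402346965063370566077229187587018588160, 3, 2348542582773833227889480475313245713578108828401410385976285178615108607107182033248751929795261230150057984) = true := by native_decide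

set_option maxRecDepth 100000 in
set_option maxHeartbeats 0 in
set_option exponentiation.threshold 1024 in
/-- K2(144) chunk fact `cube144X1_ch10_3` (249171 DFS visits; see the module docstring). -/
theorem cube144X1_ch10_3 : app5 (d144X.dfs (Ts144X.getD 1 []) 6) (55632974993001025536, 3744, 121416805764108066932466369568788790126817975180495559028717431337445215973972901888, 3, 2348542582773833227889480475313245713578108828401409993657426716947560867370343082769600923398045951147900928) = true := by native_decide

set_option maxRecDepth 100000 in
set_option maxHeartbeats 0 in
set_option exponentiation.threshold 1024 in
/-- K2(144) chunk fact `cube144X1_ch10_4` (320814 DFS visits; see the module docstring). -/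
theorem cube144X1_ch10_4 : app5 (d144X.dfs (Ts144X.getD 1 []) 6) (2656619939940280832256, 2272, 121416805764108066932466394284876873211873482783916412908903944740469778551108796416, 3, 2348542582773833227889480475313245713578108828401384885250485170224505524212650252103936513976268095009849344) = true := by native_decide
end Summit.Ventures.QEC.CircuitDistance.K2
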